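import Mathlib.Tactic.Group
import Summits.MatrixMultiplication.MatrixMultiplication.Theses.GelfandPairHosts

/-!
# `stub_designOfSaturatedTriple` — saturated TPP triples give module-TPP designs

Route `MatrixMultiplication/GelfandPairHosts`, crux `stmt-MatrixMultiplication-7381`
(`GelfandHosting`), line `birth`; registered stub `stub_designOfSaturatedTriple` (the converse half
of the route's `SaturatedRealization`).

Let a group `G` act on `X`, fix `x₀ : X`, and let `S, T, U ⊆ G` satisfy the triple product property
of Cohn–Umans 2003, Def. 2.1 in the form `s s'⁻¹ (t t'⁻¹) (u u'⁻¹) = 1 ⟹ s = s' ∧ t = t' ∧ u = u'`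
(tree: `Literature.Computability.AlgebraicComplexity.RealizesTPP`), with the third leg
right-saturated by the stabiliser of `x₀` (`u ∈ U`, `h • x₀ = x₀ ⟹ u h ∈ U`).  Enumerate
`S = {sᵢ}`, `T = {tⱼ}` and the orbit piece `P = U • x₀ = {p_k}` injectively by `Fin |S|`, `Fin |T|`,
`Fin |P|`.  Then `φ (i, j) = sᵢ⁻¹ tⱼ`, `ψ (j, k) = tⱼ⁻¹ • p_k`, `χ (i, k) = sᵢ⁻¹ • p_k` is a
module-TPP design: `φ (i, j) • ψ (j', k) = χ (i', k') ⟺ i = i' ∧ j = j' ∧ k = k'`.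

Proof.  (⇐) `(sᵢ⁻¹ tⱼ) • (tⱼ⁻¹ • p_k) = sᵢ⁻¹ • p_k`.  (⇒) Write `p_k = u • x₀`, `p_{k'} = u' • x₀`
with `u, u' ∈ U` and put `g = s_{i'} sᵢ⁻¹ tⱼ t_{j'}⁻¹`, so the hypothesis reads
`g • (u • x₀) = u' • x₀`.  Then `h = u'⁻¹ g u` fixes `x₀`, hence `u' h = g u ∈ U` by saturation,
and the TPP applied to `(s_{i'}, sᵢ, tⱼ, t_{j'}, u, u' h)` — whose product `g · (u (g u)⁻¹)` is
`1` — gives `s_{i'} = sᵢ`, `tⱼ = t_{j'}`, `u = u' h`; injectivity of the enumerations yields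
`i = i'`, `j = j'`, and `p_k = u • x₀ = u' • (h • x₀) = u' • x₀ = p_{k'}` yields `k = k'`.
-/

-- single-conjunct summit: the mandated namespace repeats `MatrixMultiplication`
set_option linter.dupNamespace false

namespace Summit.MatrixMultiplication.MatrixMultiplication.Theorems

/-- Injective enumeration of a finset by `Fin s.card` (the inverse of `Finset.equivFin`, with its
values coerced back to the ambient type). [folklore] -/
theorem stub_designOfSaturatedTriple_enum {α : Type*} (s : Finset α) :
    ∃ f : Fin s.card → α, (∀ i, f i ∈ s) ∧ Function.Injective f :=
  ⟨fun i => (s.equivFin.symm i).1, fun i => (s.equivFin.symm i).2,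
    fun _ _ hab => s.equivFin.symm.injective (Subtype.ext hab)⟩

/-- **Saturated TPP triples give module-TPP designs** (registered stub
`stub_designOfSaturatedTriple` of crux `GelfandHosting`, line `birth`): if `S, T, U ⊆ G` satisfy the
triple product property `s s'⁻¹ (t t'⁻¹) (u u'⁻¹) = 1 ⟹ s = s' ∧ t = t' ∧ u = u'` (Cohn–Umans 2003,
Def. 2.1) and `U` is right-saturated by the stabiliser of `x₀ ∈ X`
(`u ∈ U`, `h • x₀ = x₀ ⟹ u h ∈ U`), then with injective enumerations `sᵢ` of `S`, `tⱼ` of `T` and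
`p_k` of `U • x₀` the maps `φ (i, j) = sᵢ⁻¹ tⱼ`, `ψ (j, k) = tⱼ⁻¹ • p_k`, `χ (i, k) = sᵢ⁻¹ • p_k`
form a module-TPP design of size `(|S|, |T|, |U • x₀|)`:
`φ (i, j) • ψ (j', k) = χ (i', k') ⟺ i = i' ∧ j = j' ∧ k = k'`. [cite: CohnUmans2003, Def. 2.1] -/
theorem stub_designOfSaturatedTriple : ∀ (G : Type) [Group G] (X : Type) [DecidableEq X] [MulAction G X] (x₀ : X) (S T U : Finset G), (∀ s ∈ S, ∀ s' ∈ S, ∀ t ∈ T, ∀ t' ∈ T, ∀ u ∈ U, ∀ u' ∈ U, s * s'⁻¹ * (t * t'⁻¹) * (u * u'⁻¹) = 1 → s = s' ∧ t = t' ∧ u = u') → (∀ u ∈ U, ∀ h : G, h • x₀ = x₀ → u * h ∈ U) → ∃ (φ : Fin S.card × Fin T.card → G) (ψ : Fin T.card × Fin (U.image fun u => u • x₀).card → X) (χ : Fin S.card × Fin (U.image fun u => u • x₀).card → X), ∀ (i i' : Fin S.card) (j j' : Fin T.card) (k k' : Fin (U.image fun u => u • x₀).card), φ (i, j) • ψ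 (j', k) = χ (i', k') ↔ (i = i' ∧ j = j' ∧ k = k') := by
  intro G _ X _ _ x₀ S T U htpp hsat
  obtain ⟨fS, hfS, hfSi⟩ := stub_designOfSaturatedTriple_enum S
  obtain ⟨fT, hfT, hfTi⟩ := stub_designOfSaturatedTriple_enum T
  obtain ⟨fP, hfP, hfPi⟩ := stub_designOfSaturatedTriple_enum (U.image fun u => u • x₀)
  refine ⟨fun ij => (fS ij.1)⁻¹ * fT ij.2, fun jk => (fT jk.1)⁻¹ • fP jk.2,
    fun ik => (fS ik.1)⁻¹ • fP ik.2, ?_⟩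
  intro i i' j j' k k'
  dsimp only
  constructor
  · intro h
    obtain ⟨u, hu, hpk⟩ := Finset.mem_image.mp (hfP k)
    obtain ⟨u', hu', hpk'⟩ := Finset.mem_image.mp (hfP k')
    -- `g • p_k = p_{k'}` with `g = s_{i'} sᵢ⁻¹ tⱼ t_{j'}⁻¹`
    have hg : (fS i' * (fS i)⁻¹ * fT j * (fT j')⁻¹) • fP k = fP k' := by
      simp only [mul_smul] at h ⊢
      rw [h, smul_inv_smul]
    -- `h = u'⁻¹ g u` fixes `x₀`
    have hfix : (u'⁻¹ * (fS i' * (fS i)⁻¹ * fT j * (fT j')⁻¹) * u) • x₀ = x₀ := by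
      rw [mul_smul, mul_smul, hpk, hg, ← hpk', inv_smul_smul]
    -- so `u' h ∈ U` by saturation
    have hmem : u' * (u'⁻¹ * (fS i' * (fS i)⁻¹ * fT j * (fT j')⁻¹) * u) ∈ U := hsat u' hu' _ hfix
    -- the TPP relation for `(s_{i'}, sᵢ, tⱼ, t_{j'}, u, u' h)`
    have hprod : fS i' * (fS i)⁻¹ * (fT j * (fT j')⁻¹) *
        (u * (u' * (u'⁻¹ * (fS i' * (fS i)⁻¹ * fT j * (fT j')⁻¹) * u))⁻¹) = 1 := by
      group
    obtain ⟨hs, ht, hu_eq⟩ :=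
      htpp _ (hfS i') _ (hfS i) _ (hfT j) _ (hfT j') _ hu _ hmem hprod
    refine ⟨hfSi hs.symm, hfTi ht, hfPi ?_⟩
    rw [← hpk, ← hpk', hu_eq, mul_smul, hfix]
  · rintro ⟨rfl, rfl, rfl⟩
    rw [mul_smul, smul_inv_smul]

end Summit.MatrixMultiplication.MatrixMultiplication.Theorems
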